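import Summits.QuantumFields.BalabanUV.Beta.GAN24.RotatedVertexEndExitValue

/-!
# `BalabanUV.Beta.GAN24.ExitChargeSourcePairing` — binder row G-an2-4 ∕ (CONV-C), the (S) row of RULING R-gan24p1-g27-1 PART B (viii), the Ward-type half (W-γ), EXIT⊗EXIT CLASS,
# EVERY LEVEL `j+1`: **THE (γ) CHARGE OF A SLOT IS THE `n ⊗ gaugeWt` SOURCE PAIRING OF THE LITERAL RESPONSE SOURCE `𝒟_{j+1}(e)`** — the LEFT HALF of leaf-06 FILE C §3
# `GaugeReadExitPairing.maxwellRead_comp_eq_sourceRead` ∕ g46 `exitPairing_eq_source'` ONE LEVEL UP (road-P2 chair `b2b-balaban-gan24-p2`, gen 43, INTENT 2; companion of INTENT 1)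

NOT IN PRINT; OUR BOOKKEEPING ([folklore] by name: MY g42 `ChargeTowerExitOrthogonal.exists_periodic_potential_exitCharge`, MY g41 `RelInvWardPairingStep.ward_pairing_coDressKBmAt_KInvStep_succ`
(an2's `bhKStep` relative inverse), `ChargeTowerRegauge.tsum_sum_wΦ_mul_dz_eq_zero ∕ tsum_sum_wΦ_mul_axProjAt_eq`, gan24-leaf-14 `MultiplierZeroMass.tsum_wΦ_eq_zero`, leaf-06 g47 FILE C
`GaugeReadExitPairing` (§1 source-form lemmas, §2 summabilities), leaf-02's `int_ediv_add_one` (via `staircase_forwardDiff`), gen-8 `KernelLegCharges.summable_prod_of_biLoc`, leaf-06 g45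
`GaugeReadChargeProfile.biLoc_weightMul` ∕ `GaugeReadLabelSums.abs_read_le` ∕ `GaugeReadChargeComb.exists_vertexFamily_combResponse`; 0 `def`, 0 cited fact, 0 `def … : Prop`, 0 sorry).
HONEST FRAMING (cell contract, verbatim): «discharging `BetaPertH` makes Bałaban's UV stability UNCONDITIONAL — a real constructive-QFT result; it is NOT the continuum limit and NOT
the Clay problem.»  HONEST DEPENDENCY (verbatim): «continuum YM on T⁴ ⇐ BetaPertH ∧ nine spine estimates (0/9 proved); BetaPertH ⇐ (D1) ∧ (D4) ∧ CAP+tail; G-an2-4 gates asym, D1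
and NE2/3/4.»
OBJECTS as in INTENT 1 (`G = G_{j+1}`, `S = S_{j+1}`, `M = M_{j+1}`, slot `e = (ν,y′)`, label `y`, exit⊗exit weight `ω`, charge function `C_S`); `𝒟(e) := dM G Lc S M ν y′` (leaf-06 g45:
`A(e) = G ∘ 𝒟(e)`); `w_κ(u) := Σ'_x Σ_κ₂ A(e) u x (inl κ)(inl κ₂)·gaugeWt Lc y κ₂ x`; `Q^γ := Σ_κ Σ'_u w_κ(u)·C_S(κ,u)`; for a bounded 1-form `m` its SOURCE FORM
`n_m κ u := (Π^ρ m) κ u − (Lc^{d+1})⁻¹·(𝒬_{Lc} m)(κ,0)·𝟙[u_κ % Lc = Lc−1]` (leaf-06 FILE C §1; written inline — no `def`).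
* §1 **`tsum_sum_wΦ_mul_exitForm_eq_zero`**: `Σ'_v Σ_l wΦ_M κ l (u − v)·(q_l·𝟙[v_l % N = N−1]) = 0` (every `M`, `N ≥ 1`, `q`) — the exit form is `N⁻¹·(q⊙dx) + dz λ_q` with
  `λ_q(v) = Σ_l q_l·φ(v_l)`, `φ(s) = −(s % N)∕N` bounded (`sawtooth_forwardDiff`): zero `mm` mass kills the constant part, `tsum_sum_wΦ_mul_dz_eq_zero` the gradient part.
* §2 **`tsum_sum_wΦ_mul_sourceForm_eq`**: the `wΦ`-image of `n_m` is that of `m`.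
* §3 **`exitPairing_eq_source_succ`** (g46 one level up; `W` spread, `m` bounded `Lc`-periodic): the `wVH_{j+1}·wΦ`-image of `m` read against the field rows of `G_{j+1}∘W` is
  `Σ'_u Σ_κ n_m κ u·W u x (inl κ) b` — §2 ⨾ the Ward pairing at step `j+1` with the comb-free CONTOUR-FREE `n_m` (no multiplier term); §4 **`E2imageRead_comp_eq_sourceRead_succ`** = FILE C §3
  one level up (Fubini with a bounded `dzψ`).
* §5 **`gaugeCharge_exit_eq_sourcePairing`**: `∃ m` (MY g42 tower's potential) with `Q^γ = Σ'_x Σ_κ₂ gaugeWt Lc y κ₂ x·(Σ'_u Σ_κ n_m κ u·𝒟(e) u x (inl κ)(inl κ₂))` — leaf-06 FILE B §3's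
  LEFT side one level up; §6 **`wardGamma_exit_of_sourcePairing`**: IF that source pairing is `c·R^{(j+1)}_{αβ}(e; y)` (INTENT 1 §4; DISPLAYED — the level-(j+1) twin of leaf-06's
  ENGINE (M1)+(M3), NOT typed) THEN `Q^γ = (−4c)·V⁺` — FILE F §2 one level up.
READING.  (W-γ)_{j+1} is now a statement about the SECOND-LEG GAUGE LAW of the level-(j+1) tables against `n_m` (level 0: the letters' laws `CombFreeGaugeLegCharges.wilsonA_gaugeLeg_charge` ∕
`hessFFAt_gaugeLeg_charge`; level `j+1`: `S_{j+1} = (cE·wE)•e3OfK Lc G_j (SrecAt j) + VH` pulls the gauged leg back through `G_j` to `cH_j·dz(ψ∘blk)` (MY g41 `CoarseGaugeSourceResponse`) —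
a recursion; road-P2 memo `HOME/b2b-balaban-gan24-p2/gen43/W-GAMMA-LEVELN-GAMMA.md`).
Asserts NO value of any resolvent column or of Bałaban's tables; NOTHING of (W-γ)'s (γ) read at levels ≥ 1 ∕ (INV-Z) ∕ (S) ∕ (Q-R) ∕ (LT) ∕ (Q-L) ∕ (C) ∕ «T2Shape» ∕ (hW, hWall)
discharged; NEVER «G-an2-4 closed» as (CONV-C); NOT D1, NOT `BetaPertH`, NOT continuum, NOT Clay.  2026-08-22; no existing file touched.
-/


noncomputable section

open Finset
open scoped BigOperators
open Literature.MathematicalPhysics.QuantumFieldTheory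
open Literature.MathematicalPhysics.QuantumFieldTheory.Balaban1983to89
open Literature.MathematicalPhysics.QuantumFieldTheory.Balaban1983to89.Beta
open B12Sec2to5 (l1 l1_nonneg)
open ExpKernelCalculus (Site MKer Decays BiLoc VertexFamily Zl comp summable_exp_shift' biLoc_comp_decays)
open AffineAveraging (Form0 Form1 box toSite unitVec unitVec_apply dz contourSum)
open AveragingContours (blk)
open RootedComb (axProjAt)
open KernelSpecInstance (wΦ)
open OneStepResolventKernel (Fib LocStencil decays_mono biLoc_mono)
open OneStepKernelFamily (KInvStep colH)
open SecondOrderResponse (colM dM vertexFamily_dM)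
open BalabanStepJets (locStencil_mono)
open BalabanStepJetsSucc (wVH)
open Summit.QuantumFields.BalabanUV.Beta.TameKernelCalculus (Spr)
open Summit.QuantumFields.BalabanUV.Beta.AxialDressingRooted (IsCombBondAt coDressKBmAt decays_coDressKBmAt_KInvStep one_le_of_neZero)
open Summit.QuantumFields.BalabanUV.Beta.SpineRooted (SpureRecAt M1At locStencil_SpureRecAt vertexFamily_M1At)
open Summit.QuantumFields.BalabanUV.Beta.KernelWardRelative (gaugeWt)
open Summit.QuantumFields.BalabanUV.Beta.KernelWardResponse (decays_of_biLoc)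
open Summit.QuantumFields.BalabanUV.Beta.KernelWardResidual (abs_gaugeWt_le_one)
open KKTFluctuationEnergy (abs_dz_le)
open Summit.QuantumFields.BalabanUV.Beta.GAN24.KernelLegCharges (summable_prod_of_biLoc)
open Summit.QuantumFields.BalabanUV.Beta.GAN24.GaugeReadChargeProfile (biLoc_weightMul)
open Summit.QuantumFields.BalabanUV.Beta.GAN24.GaugeReadLabelSums (abs_read_le)
open Summit.QuantumFields.BalabanUV.Beta.GAN24.GaugeReadChargeComb (exists_vertexFamily_combResponse)
open Summit.QuantumFields.BalabanUV.Beta.GAN24.CombSlotDerivativeBorderRead (gaugeWt_eq_dz)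
open Summit.QuantumFields.BalabanUV.Beta.GAN24.MultiplierZeroMass (summable_wΦ tsum_wΦ_eq_zero)
open Summit.QuantumFields.BalabanUV.Beta.GAN24.CoarseGaugeSourceResponse (summable_bdd_mul)
open Summit.QuantumFields.BalabanUV.Beta.GAN24.GaugeReadExitPairing (sourceForm_eq_zero_of_isCombBond abs_sourceForm_le contourSum_sourceForm_eq_zero summable_mul_col_of_biLoc
  summable_row_mul_of_biLoc)
open Summit.QuantumFields.BalabanUV.Beta.GAN24.RelInvWardPairingStep (ward_pairing_coDressKBmAt_KInvStep_succ)
open Summit.QuantumFields.BalabanUV.Beta.GAN24.ChargeTowerClimb (abs_tsum_sum_wΦ_mul_le)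
open Summit.QuantumFields.BalabanUV.Beta.GAN24.ChargeTowerRegauge (summable_wΦ_shift_mul tsum_sum_wΦ_mul_dz_eq_zero tsum_sum_wΦ_mul_axProjAt_eq)
open Summit.QuantumFields.BalabanUV.Beta.GAN24.ChargeTowerInduction (staircase_forwardDiff)
open Summit.QuantumFields.BalabanUV.Beta.GAN24.ChargeTowerExitOrthogonal (exists_periodic_potential_exitCharge)
open Summit.QuantumFields.BalabanUV.Beta.GAN24.RotatedVertexEndExitValue (wardGamma_exit_of_gammaRead)

namespace Summit.QuantumFields.BalabanUV.Beta.GAN24.ExitChargeSourcePairing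

variable {d : ℕ} {Lc : ℕ} [NeZero Lc] {r : Fin (d + 1) → ℕ}

/-! ## §1 The value-Hessian image of the exit form vanishes -/

omit [NeZero Lc] in
/-- [folklore] A bounded function against the `u − ·`-shifted row of `wΦ` is summable, and so is a finite sum of such rows. -/
theorem summable_wΦ_sub_mul (M : ℕ) [NeZero M] {g : Site (d + 1) → ℝ} {B : ℝ} (hg : ∀ v, |g v| ≤ B) (κ l : Fin (d + 1)) (u : Site (d + 1)) :
    Summable fun v : Site (d + 1) => wΦ (N := M) κ l (u - v) * g v := by
  have h := summable_wΦ_shift_mul M hg κ l u 0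
  simpa only [sub_zero] using h

omit [NeZero Lc] in
/-- [folklore] … and so is a finite sum of such rows against a bounded 1-form. -/
theorem summable_sum_wΦ_sub_mul (M : ℕ) [NeZero M] {g : Form1 (d + 1) ℝ} {B : ℝ} (hg : ∀ l v, |g l v| ≤ B) (κ : Fin (d + 1)) (u : Site (d + 1)) :
    Summable fun v : Site (d + 1) => ∑ l : Fin (d + 1), wΦ (N := M) κ l (u - v) * g l v :=
  summable_sum fun l _ => summable_wΦ_sub_mul M (hg l) κ l u

omit [NeZero Lc] in
/-- [folklore] The `u − ·`-shifted row of `wΦ` has zero total (zero `mm` mass, gan24-leaf-14 `tsum_wΦ_eq_zero`, re-indexed by `v ↦ u − v`). -/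
theorem tsum_wΦ_sub_eq_zero (M : ℕ) [NeZero M] (κ l : Fin (d + 1)) (u : Site (d + 1)) : ∑' v : Site (d + 1), wΦ (N := M) κ l (u - v) = 0 := by
  have h := (Equiv.subLeft u).tsum_eq (fun z : Site (d + 1) => wΦ (N := M) κ l z)
  simp only [Equiv.subLeft_apply] at h
  rw [h, tsum_wΦ_eq_zero]

omit [NeZero Lc] in
/-- [folklore] The sawtooth `φ(s) = −(s % N)∕N` is a bounded function whose forward difference is the exit indicator minus its mean:
`φ(t+1) − φ(t) = 𝟙[t % N = N−1] − N⁻¹` (`1 ≤ N`; `Int.emod_def` ⨾ MY g42 `staircase_forwardDiff`). -/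
theorem sawtooth_forwardDiff {N : ℕ} (hN : 1 ≤ N) (t : ℤ) :
    (-((((t + 1) % (N : ℤ) : ℤ)) : ℝ) / N) - (-(((t % (N : ℤ) : ℤ)) : ℝ) / N) = (if t % (N : ℤ) = (N : ℤ) - 1 then (1 : ℝ) else 0) - (N : ℝ)⁻¹ := by
  have hN0 : (N : ℝ) ≠ 0 := by exact_mod_cast (show N ≠ 0 by omega)
  rw [← staircase_forwardDiff hN t, Int.emod_def, Int.emod_def]
  push_cast
  field_simp
  ring

omit [NeZero Lc] in
/-- [folklore] … and it is bounded by `1`. -/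
theorem abs_sawtooth_le {N : ℕ} (hN : 1 ≤ N) (t : ℤ) : |(-(((t % (N : ℤ) : ℤ)) : ℝ) / N)| ≤ 1 := by
  have hN0 : (0 : ℤ) < N := by exact_mod_cast hN
  have h0 : (0 : ℝ) ≤ ((t % (N : ℤ) : ℤ) : ℝ) := by exact_mod_cast Int.emod_nonneg t hN0.ne'
  have h1 : ((t % (N : ℤ) : ℤ) : ℝ) < (N : ℝ) := by exact_mod_cast Int.emod_lt_of_pos t hN0
  rw [abs_div, abs_neg, abs_of_nonneg h0, abs_of_pos (by exact_mod_cast hN0 : (0 : ℝ) < N), div_le_one (by exact_mod_cast hN0 : (0 : ℝ) < N)]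
  exact h1.le

omit [NeZero Lc] in
/-- NOT IN PRINT; OUR BOOKKEEPING.  **THE VALUE-HESSIAN IMAGE OF THE EXIT FORM VANISHES** (every blocking `M`, every period `N ≥ 1`, every direction coefficients `q`, every slot `(κ,u)`):
`Σ'_v Σ_l wΦ_M κ l (u − v)·(q_l·𝟙[v_l % N = N−1]) = 0`.  The exit form is `N⁻¹·(q⊙dx) + dz λ_q`, `λ_q(v) = Σ_l q_l·φ(v_l)` bounded: the constant part has zero image (zero `mm` mass),
the gradient part has zero image (MY g41 `tsum_sum_wΦ_mul_dz_eq_zero`). -/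
theorem tsum_sum_wΦ_mul_exitForm_eq_zero (M : ℕ) [NeZero M] {N : ℕ} (hN : 1 ≤ N) (q : Fin (d + 1) → ℝ) (κ : Fin (d + 1)) (u : Site (d + 1)) :
    ∑' v, ∑ l : Fin (d + 1), wΦ (N := M) κ l (u - v) * (q l * (if v l % (N : ℤ) = (N : ℤ) - 1 then (1 : ℝ) else 0)) = 0 := by
  classical
  set lam : Form0 (d + 1) ℝ := fun v => ∑ l : Fin (d + 1), q l * (-(((v l % (N : ℤ) : ℤ)) : ℝ) / N) with hlam
  have hlamB : ∀ v, |lam v| ≤ ∑ l : Fin (d + 1), |q l| := fun v => by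
    refine (Finset.abs_sum_le_sum_abs _ _).trans (Finset.sum_le_sum fun l _ => ?_)
    rw [abs_mul]
    exact (mul_le_mul_of_nonneg_left (abs_sawtooth_le hN (v l)) (abs_nonneg _)).trans (by rw [mul_one])
  have hdz : ∀ (l : Fin (d + 1)) (v : Site (d + 1)),
      dz lam l v = q l * (if v l % (N : ℤ) = (N : ℤ) - 1 then (1 : ℝ) else 0) - q l * (N : ℝ)⁻¹ := by
    intro l v
    simp only [dz, hlam]
    rw [← Finset.sum_sub_distrib, Finset.sum_eq_single l]
    · rw [Pi.add_apply, unitVec_apply, if_pos rfl, ← mul_sub, sawtooth_forwardDiff hN, mul_sub]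
    · intro l' _ hl'
      rw [Pi.add_apply, unitVec_apply, if_neg hl', add_zero, sub_self]
    · intro h; exact (h (Finset.mem_univ l)).elim
  have e : ∀ v, (∑ l : Fin (d + 1), wΦ (N := M) κ l (u - v) * (q l * (if v l % (N : ℤ) = (N : ℤ) - 1 then (1 : ℝ) else 0)))
      = (∑ l : Fin (d + 1), wΦ (N := M) κ l (u - v) * dz lam l v) + ∑ l : Fin (d + 1), wΦ (N := M) κ l (u - v) * (q l * (N : ℝ)⁻¹) := by
    intro v
    rw [← Finset.sum_add_distrib]
    exact Finset.sum_congr rfl fun l _ => by rw [hdz]; ring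
  have hdzB : ∀ l v, |dz lam l v| ≤ 2 * ∑ l : Fin (d + 1), |q l| := fun l v => abs_dz_le hlamB l v
  have hs1 := summable_sum_wΦ_sub_mul M hdzB κ u
  have hs2 := summable_sum_wΦ_sub_mul M (g := fun l _ => q l * (N : ℝ)⁻¹) (B := (∑ l : Fin (d + 1), |q l|) * |(N : ℝ)⁻¹|)
    (fun l v => by rw [abs_mul]; exact mul_le_mul_of_nonneg_right (Finset.single_le_sum (fun l _ => abs_nonneg (q l)) (Finset.mem_univ l)) (abs_nonneg _)) κ u
  rw [tsum_congr e, hs1.tsum_add hs2, tsum_sum_wΦ_mul_dz_eq_zero M hlamB κ u, zero_add]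
  rw [Summable.tsum_finsetSum (fun l _ => ?_)]
  · refine Finset.sum_eq_zero fun l _ => ?_
    rw [tsum_mul_right, tsum_wΦ_sub_eq_zero, zero_mul]
  · exact summable_wΦ_sub_mul M (g := fun _ => q l * (N : ℝ)⁻¹) (B := |q l * (N : ℝ)⁻¹|) (fun _ => le_rfl) κ l u

/-- NOT IN PRINT; OUR BOOKKEEPING.  **THE `wΦ`-IMAGE OF THE SOURCE FORM `n_m = Π^ρ m − (Lc^{d+1})⁻¹·(𝒬m)(·,0)⊙𝟙^{exit}` IS THAT OF `m`** (in-block root, every blocking `M`, bounded `m`):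
MY g41 `tsum_sum_wΦ_mul_axProjAt_eq` (the hard-axial representative) and §1 (the exit form). -/
theorem tsum_sum_wΦ_mul_sourceForm_eq (M : ℕ) [NeZero M] (hr : r ∈ box (d + 1) Lc) {m : Form1 (d + 1) ℝ} {B : ℝ} (hmB : ∀ κ u, |m κ u| ≤ B)
    (κ : Fin (d + 1)) (u : Site (d + 1)) :
    ∑' v, ∑ l : Fin (d + 1), wΦ (N := M) κ l (u - v)
        * (axProjAt (toSite r) Lc m l v - ((Lc : ℝ) ^ (d + 1))⁻¹ * (contourSum Lc m l 0 * (if v l % (Lc : ℤ) = (Lc : ℤ) - 1 then (1 : ℝ) else 0)))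
      = ∑' v, ∑ l : Fin (d + 1), wΦ (N := M) κ l (u - v) * m l v := by
  have hLc : 1 ≤ Lc := one_le_of_neZero Lc
  have hPi : ∀ l v, |axProjAt (toSite r) Lc m l v| ≤ B + 2 * ((((d + 1 : ℕ) : ℝ)) * Lc * B) := fun l v => EdgePotentialColumnOrthogonal.abs_axProjAt_le hLc hr hmB l v
  have hE : ∀ (l : Fin (d + 1)) (v : Site (d + 1)), |((Lc : ℝ) ^ (d + 1))⁻¹ * (contourSum Lc m l 0 * (if v l % (Lc : ℤ) = (Lc : ℤ) - 1 then (1 : ℝ) else 0))|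
      ≤ |((Lc : ℝ) ^ (d + 1))⁻¹| * ∑ l : Fin (d + 1), |contourSum Lc m l 0| := fun l v => by
    rw [abs_mul, abs_mul]
    refine mul_le_mul_of_nonneg_left ?_ (abs_nonneg _)
    refine le_trans ?_ (Finset.single_le_sum (fun l _ => abs_nonneg (contourSum Lc m l 0)) (Finset.mem_univ l))
    have h1 : |(if v l % (Lc : ℤ) = (Lc : ℤ) - 1 then (1 : ℝ) else 0)| ≤ 1 := by split_ifs <;> simp
    exact (mul_le_mul_of_nonneg_left h1 (abs_nonneg _)).trans (by rw [mul_one])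
  have hs1 := summable_sum_wΦ_sub_mul M hPi κ u
  have hs2 := summable_sum_wΦ_sub_mul M hE κ u
  have e : ∀ v, (∑ l : Fin (d + 1), wΦ (N := M) κ l (u - v)
        * (axProjAt (toSite r) Lc m l v - ((Lc : ℝ) ^ (d + 1))⁻¹ * (contourSum Lc m l 0 * (if v l % (Lc : ℤ) = (Lc : ℤ) - 1 then (1 : ℝ) else 0))))
      = (∑ l : Fin (d + 1), wΦ (N := M) κ l (u - v) * axProjAt (toSite r) Lc m l v)
        - ∑ l : Fin (d + 1), wΦ (N := M) κ l (u - v) * (((Lc : ℝ) ^ (d + 1))⁻¹ * (contourSum Lc m l 0 * (if v l % (Lc : ℤ) = (Lc : ℤ) - 1 then (1 : ℝ) else 0))) := by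
    intro v
    rw [← Finset.sum_sub_distrib]
    exact Finset.sum_congr rfl fun l _ => by ring
  have e2 : ∀ v, (∑ l : Fin (d + 1), wΦ (N := M) κ l (u - v) * (((Lc : ℝ) ^ (d + 1))⁻¹ * (contourSum Lc m l 0 * (if v l % (Lc : ℤ) = (Lc : ℤ) - 1 then (1 : ℝ) else 0))))
      = ((Lc : ℝ) ^ (d + 1))⁻¹ * ∑ l : Fin (d + 1), wΦ (N := M) κ l (u - v) * (contourSum Lc m l 0 * (if v l % (Lc : ℤ) = (Lc : ℤ) - 1 then (1 : ℝ) else 0)) := by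
    intro v
    rw [Finset.mul_sum]
    exact Finset.sum_congr rfl fun l _ => by ring
  rw [tsum_congr e, hs1.tsum_sub hs2, tsum_sum_wΦ_mul_axProjAt_eq M hr hmB κ u, tsum_congr e2, tsum_mul_left,
    tsum_sum_wΦ_mul_exitForm_eq_zero M hLc (fun l => contourSum Lc m l 0) κ u, mul_zero, sub_zero]

/-- NOT IN PRINT; OUR BOOKKEEPING.  **g46 `exitPairing_eq_source'` ONE LEVEL UP** (in-block root `ρ = toSite r`, every `j`, every SPREAD `W`, every bounded `Lc`-PERIODIC `m`, every fine leg
`(x, b)`): the `wVH_{j+1}·wΦ_{Lc^{j+1}}`-image of `m` read against the field rows of `G_{j+1} ∘ W` is the `n_m`-weighted column of `W`: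
`Σ'_u Σ_κ (wVH_{j+1}·Σ'_v Σ_l wΦ κ l (u−v)·m l v)·(G_{j+1}∘W)(u,x)(inl κ, b) = Σ'_u Σ_κ n_m κ u·W u x (inl κ) b` — §2 turns the image of `m` into the image of `n_m`; `n_m` is bounded,
vanishes on the comb bonds and has ZERO block contour sums (leaf-06 FILE C §1), so MY g41 `ward_pairing_coDressKBmAt_KInvStep_succ` has no multiplier term. -/
theorem exitPairing_eq_source_succ (hr : r ∈ box (d + 1) Lc) (j : ℕ) {W : MKer (d + 1) (Fib d)} (hWs : Spr W)
    {m : Form1 (d + 1) ℝ} {B : ℝ} (hmB : ∀ κ u, |m κ u| ≤ B) (hper : ∀ κ x v, m κ (x + (Lc : ℤ) • v) = m κ x) (x : Site (d + 1)) (b : Fib d) :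
    ∑' u, ∑ κ, (wVH d Lc (j + 1) * ∑' v, ∑ l : Fin (d + 1), wΦ (N := Lc ^ (j + 1)) κ l (u - v) * m l v)
        * comp (coDressKBmAt (toSite r) Lc (KInvStep (d := d) Lc (j + 1))) W u x (Sum.inl κ) b
      = ∑' u, ∑ κ, (axProjAt (toSite r) Lc m κ u - ((Lc : ℝ) ^ (d + 1))⁻¹ * (contourSum Lc m κ 0 * (if u κ % (Lc : ℤ) = (Lc : ℤ) - 1 then (1 : ℝ) else 0)))
          * W u x (Sum.inl κ) b := by
  classical
  have hLc : 1 ≤ Lc := one_le_of_neZero Lc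
  have e : ∀ u, (∑ κ, (wVH d Lc (j + 1) * ∑' v, ∑ l : Fin (d + 1), wΦ (N := Lc ^ (j + 1)) κ l (u - v) * m l v)
        * comp (coDressKBmAt (toSite r) Lc (KInvStep (d := d) Lc (j + 1))) W u x (Sum.inl κ) b)
      = ∑ κ, (wVH d Lc (j + 1) * ∑' v, ∑ l : Fin (d + 1), wΦ (N := Lc ^ (j + 1)) κ l (u - v)
          * (axProjAt (toSite r) Lc m l v - ((Lc : ℝ) ^ (d + 1))⁻¹ * (contourSum Lc m l 0 * (if v l % (Lc : ℤ) = (Lc : ℤ) - 1 then (1 : ℝ) else 0))))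
        * comp (coDressKBmAt (toSite r) Lc (KInvStep (d := d) Lc (j + 1))) W u x (Sum.inl κ) b :=
    fun u => Finset.sum_congr rfl fun κ _ => by rw [tsum_sum_wΦ_mul_sourceForm_eq (Lc ^ (j + 1)) hr hmB κ u]
  rw [tsum_congr e]
  have hnB := fun κ u => abs_sourceForm_le hLc hr hmB (((Lc : ℝ) ^ (d + 1))⁻¹) (fun κ' => contourSum Lc m κ' 0) κ u
  have hn0 : ∀ κ u, IsCombBondAt (toSite r) Lc κ u →
      (fun κ' u => axProjAt (toSite r) Lc m κ' u - ((Lc : ℝ) ^ (d + 1))⁻¹ * (contourSum Lc m κ' 0 * (if u κ' % (Lc : ℤ) = (Lc : ℤ) - 1 then (1 : ℝ) else 0))) κ u = 0 :=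
    fun κ u h => sourceForm_eq_zero_of_isCombBond hLc (toSite r) m (((Lc : ℝ) ^ (d + 1))⁻¹) (fun κ' => contourSum Lc m κ' 0) h
  rw [ward_pairing_coDressKBmAt_KInvStep_succ hr j hWs hnB hn0 x b]
  simp only [contourSum_sourceForm_eq_zero r hper, zero_mul, Finset.sum_const_zero, tsum_zero, mul_zero, add_zero]

/-- NOT IN PRINT; OUR BOOKKEEPING.  **FILE C §3 `maxwellRead_comp_eq_sourceRead` ONE LEVEL UP** (in-block root; every `j`; `W` spread and bi-localised; `m` bounded `Lc`-periodic; `ψ` bounded):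
the `wVH_{j+1}·wΦ`-image of `m` read against the `dzψ`-weighted field rows of `G_{j+1}∘W` is `Σ'_x Σ_κ₂ dzψ κ₂ x·(Σ'_u Σ_κ n_m κ u·W u x (inl κ)(inl κ₂))` — Fubini + §3 per `(x, κ₂)`. -/
theorem E2imageRead_comp_eq_sourceRead_succ (hr : r ∈ box (d + 1) Lc) (j : ℕ) {W : MKer (d + 1) (Fib d)} (hWs : Spr W) {CW δW : ℝ}
    {p₀ q₀ : Site (d + 1)} (hW : BiLoc W p₀ q₀ CW δW) (hδW : 0 < δW) {m : Form1 (d + 1) ℝ} {B : ℝ} (hmB : ∀ κ u, |m κ u| ≤ B)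
    (hper : ∀ κ x v, m κ (x + (Lc : ℤ) • v) = m κ x) {ψ : Site (d + 1) → ℝ} {Bψ : ℝ} (hψ : ∀ u, |ψ u| ≤ Bψ) :
    ∑' u, ∑ κ, (wVH d Lc (j + 1) * ∑' v, ∑ l : Fin (d + 1), wΦ (N := Lc ^ (j + 1)) κ l (u - v) * m l v)
        * (∑' x, ∑ κ₂, comp (coDressKBmAt (toSite r) Lc (KInvStep (d := d) Lc (j + 1))) W u x (Sum.inl κ) (Sum.inl κ₂) * dz ψ κ₂ x)
      = ∑' x, ∑ κ₂, dz ψ κ₂ x * (∑' u, ∑ κ,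
          (axProjAt (toSite r) Lc m κ u - ((Lc : ℝ) ^ (d + 1))⁻¹ * (contourSum Lc m κ 0 * (if u κ % (Lc : ℤ) = (Lc : ℤ) - 1 then (1 : ℝ) else 0)))
            * W u x (Sum.inl κ) (Sum.inl κ₂)) := by
  classical
  have hLc : 1 ≤ Lc := one_le_of_neZero Lc
  set G := coDressKBmAt (toSite r) Lc (KInvStep (d := d) Lc (j + 1)) with hGdef
  set E : Form1 (d + 1) ℝ := fun κ u => wVH d Lc (j + 1) * ∑' v, ∑ l : Fin (d + 1), wΦ (N := Lc ^ (j + 1)) κ l (u - v) * m l v with hEdef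
  obtain ⟨δG, CG, hδG, hCG, hG⟩ := decays_coDressKBmAt_KInvStep (d := d) hr (j + 1)
  set δ₀ : ℝ := min δG δW with hδ₀def
  have hδ₀ : 0 < δ₀ := lt_min hδG hδW
  have hCW : 0 ≤ CW := hW.nonneg (Sum.inl 0)
  have hG' : Decays G CG δ₀ := decays_mono hG hCG le_rfl (min_le_left _ _)
  have hW' : BiLoc W p₀ q₀ CW δ₀ := biLoc_mono hW hCW (min_le_right _ _)
  have hA := biLoc_comp_decays hG' hW' (show (0 : ℝ) ≤ δ₀ / 2 by positivity) (by linarith)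
  have hδA : 0 < δ₀ / 2 := by positivity
  have hB0 : 0 ≤ B := (abs_nonneg _).trans (hmB 0 0)
  set BD : ℝ := |wVH d Lc (j + 1)| * (B * ∑ κ : Fin (d + 1), ∑ l : Fin (d + 1), ∑' z : Site (d + 1), |wΦ (N := Lc ^ (j + 1)) κ l z|) with hBDdef
  have hD : ∀ κ u, |E κ u| ≤ BD := by
    intro κ u
    simp only [hEdef, hBDdef]
    rw [abs_mul]
    refine mul_le_mul_of_nonneg_left ((abs_tsum_sum_wΦ_mul_le (Lc ^ (j + 1)) hmB κ u).trans (mul_le_mul_of_nonneg_left ?_ hB0)) (abs_nonneg _)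
    exact Finset.single_le_sum (f := fun κ => ∑ l : Fin (d + 1), ∑' z : Site (d + 1), |wΦ (N := Lc ^ (j + 1)) κ l z|)
      (fun κ _ => Finset.sum_nonneg fun l _ => tsum_nonneg fun z => abs_nonneg _) (Finset.mem_univ κ)
  have hdz : ∀ κ x, |dz ψ κ x| ≤ 2 * Bψ := fun κ x => abs_dz_le hψ κ x
  have hω : ∀ (κ κ₂ : Fin (d + 1)) (xz : Site (d + 1) × Site (d + 1)), |E κ xz.1 * dz ψ κ₂ xz.2| ≤ BD * (2 * Bψ) := fun κ κ₂ xz => by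
    rw [abs_mul]; exact mul_le_mul (hD κ xz.1) (hdz κ₂ xz.2) (abs_nonneg _) ((abs_nonneg _).trans (hD κ xz.1))
  have hsF : Summable fun ux : Site (d + 1) × Site (d + 1) => ∑ κ, ∑ κ₂, (E κ ux.1 * dz ψ κ₂ ux.2) * comp G W ux.1 ux.2 (Sum.inl κ) (Sum.inl κ₂) :=
    summable_sum fun κ _ => summable_sum fun κ₂ _ => summable_prod_of_biLoc (biLoc_weightMul hA (hω κ κ₂)) hδA (Sum.inl κ) (Sum.inl κ₂)
  have hsU : Summable (Function.uncurry fun u x => ∑ κ, ∑ κ₂, (E κ u * dz ψ κ₂ x) * comp G W u x (Sum.inl κ) (Sum.inl κ₂)) := hsF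
  have eL : ∀ u, (∑ κ, E κ u * (∑' x, ∑ κ₂, comp G W u x (Sum.inl κ) (Sum.inl κ₂) * dz ψ κ₂ x))
      = ∑' x, ∑ κ, ∑ κ₂, (E κ u * dz ψ κ₂ x) * comp G W u x (Sum.inl κ) (Sum.inl κ₂) := by
    intro u
    have hs : ∀ κ, Summable fun x => ∑ κ₂, comp G W u x (Sum.inl κ) (Sum.inl κ₂) * dz ψ κ₂ x :=
      fun κ => summable_sum fun κ₂ _ => summable_row_mul_of_biLoc hA hδA (hdz κ₂) u (Sum.inl κ) (Sum.inl κ₂)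
    calc (∑ κ, E κ u * (∑' x, ∑ κ₂, comp G W u x (Sum.inl κ) (Sum.inl κ₂) * dz ψ κ₂ x))
        = ∑ κ, ∑' x, E κ u * ∑ κ₂, comp G W u x (Sum.inl κ) (Sum.inl κ₂) * dz ψ κ₂ x :=
          Finset.sum_congr rfl fun κ _ => tsum_mul_left.symm
      _ = ∑' x, ∑ κ, E κ u * ∑ κ₂, comp G W u x (Sum.inl κ) (Sum.inl κ₂) * dz ψ κ₂ x :=
          (Summable.tsum_finsetSum (fun κ _ => (hs κ).mul_left _)).symm
      _ = _ := tsum_congr fun x => Finset.sum_congr rfl fun κ _ => by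
          rw [Finset.mul_sum]; exact Finset.sum_congr rfl fun κ₂ _ => by ring
  have eL0 : (∑' u, ∑ κ, (wVH d Lc (j + 1) * ∑' v, ∑ l : Fin (d + 1), wΦ (N := Lc ^ (j + 1)) κ l (u - v) * m l v)
        * (∑' x, ∑ κ₂, comp G W u x (Sum.inl κ) (Sum.inl κ₂) * dz ψ κ₂ x))
      = ∑' u, ∑ κ, E κ u * (∑' x, ∑ κ₂, comp G W u x (Sum.inl κ) (Sum.inl κ₂) * dz ψ κ₂ x) := rfl
  rw [eL0, tsum_congr eL, ← hsU.tsum_comm]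
  refine tsum_congr fun x => ?_
  have hsu : ∀ κ κ₂, Summable fun u => E κ u * comp G W u x (Sum.inl κ) (Sum.inl κ₂) :=
    fun κ κ₂ => summable_mul_col_of_biLoc hA hδA (hD κ) x (Sum.inl κ) (Sum.inl κ₂)
  have e1 : ∑' u, ∑ κ, ∑ κ₂, (E κ u * dz ψ κ₂ x) * comp G W u x (Sum.inl κ) (Sum.inl κ₂)
      = ∑ κ₂, dz ψ κ₂ x * ∑' u, ∑ κ, E κ u * comp G W u x (Sum.inl κ) (Sum.inl κ₂) := by
    have e : ∀ u, (∑ κ, ∑ κ₂, (E κ u * dz ψ κ₂ x) * comp G W u x (Sum.inl κ) (Sum.inl κ₂))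
        = ∑ κ₂, dz ψ κ₂ x * ∑ κ, E κ u * comp G W u x (Sum.inl κ) (Sum.inl κ₂) := by
      intro u
      rw [Finset.sum_comm]
      refine Finset.sum_congr rfl fun κ₂ _ => ?_
      rw [Finset.mul_sum]
      exact Finset.sum_congr rfl fun κ _ => by ring
    rw [tsum_congr e, Summable.tsum_finsetSum (fun κ₂ _ => (summable_sum fun κ _ => hsu κ κ₂).mul_left _)]
    exact Finset.sum_congr rfl fun κ₂ _ => tsum_mul_left
  rw [e1]
  refine Finset.sum_congr rfl fun κ₂ _ => ?_
  congr 1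
  exact exitPairing_eq_source_succ hr j hWs hmB hper x (Sum.inl κ₂)

/-- NOT IN PRINT; OUR BOOKKEEPING.  **THE (γ) exit⊗exit CHARGE OF THE SLOT IS THE `n_m ⊗ gaugeWt` SOURCE PAIRING OF `𝒟_{j+1}(e)`** (in-block root, `α ≠ β`, all `cE cVH cΛ`, every `j`):
`∃ m` bounded, comb-zero, `Lc`-periodic with `C_S = wVH_{j+1}·(wΦ_{Lc^{j+1}}-image of m)` (MY g42 tower) and, for every slot `(ν, y′)` and label `y`,
`Σ_κ Σ'_u w_κ(u)·C_S(κ,u) = Σ'_x Σ_κ₂ gaugeWt Lc y κ₂ x·(Σ'_u Σ_κ n_m κ u·𝒟(e) u x (inl κ)(inl κ₂))` — leaf-06 FILE B §3's LEFT side one level up. -/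
theorem gaugeCharge_exit_eq_sourcePairing (hr : r ∈ box (d + 1) Lc) (cE cVH cΛ : ℝ) {α β : Fin (d + 1)} (hαβ : α ≠ β) (j : ℕ) :
    ∃ m : Form1 (d + 1) ℝ, (∃ B : ℝ, ∀ κ u, |m κ u| ≤ B) ∧ (∀ κ u, IsCombBondAt (toSite r) Lc κ u → m κ u = 0) ∧
      (∀ κ x v, m κ (x + (Lc : ℤ) • v) = m κ x) ∧
      (∀ (ν : Fin (d + 1)) (y' : Site (d + 1)), ∑' xz : Site (d + 1) × Site (d + 1),
        (if xz.1 α % (Lc : ℤ) = (Lc : ℤ) - 1 then (1 : ℝ) else 0) * (if xz.2 β % (Lc : ℤ) = (Lc : ℤ) - 1 then (1 : ℝ) else 0)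
          * SpureRecAt d Lc (toSite r) cE cVH cΛ (j + 1) ν y' xz.1 xz.2 (Sum.inl α) (Sum.inl β)
        = wVH d Lc (j + 1) * ∑' v, ∑ l : Fin (d + 1), wΦ (N := Lc ^ (j + 1)) ν l (y' - v) * m l v) ∧
      ∀ (ν : Fin (d + 1)) (y' y : Site (d + 1)),
        (∑ κ : Fin (d + 1), ∑' u : Site (d + 1),
          (∑' x, ∑ κ₂, comp (coDressKBmAt (toSite r) Lc (KInvStep (d := d) Lc (j + 1)))
              (dM (coDressKBmAt (toSite r) Lc (KInvStep (d := d) Lc (j + 1))) Lc (SpureRecAt d Lc (toSite r) cE cVH cΛ (j + 1)) (M1At d Lc (toSite r) cΛ (j + 1)) ν y')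
              u x (Sum.inl κ) (Sum.inl κ₂) * gaugeWt Lc y κ₂ x)
            * ∑' xz : Site (d + 1) × Site (d + 1), ((if xz.1 α % (Lc : ℤ) = (Lc : ℤ) - 1 then (1 : ℝ) else 0) * (if xz.2 β % (Lc : ℤ) = (Lc : ℤ) - 1 then (1 : ℝ) else 0))
                * SpureRecAt d Lc (toSite r) cE cVH cΛ (j + 1) κ u xz.1 xz.2 (Sum.inl α) (Sum.inl β))
        = ∑' x, ∑ κ₂, gaugeWt Lc y κ₂ x * (∑' u, ∑ κ,
            (axProjAt (toSite r) Lc m κ u - ((Lc : ℝ) ^ (d + 1))⁻¹ * (contourSum Lc m κ 0 * (if u κ % (Lc : ℤ) = (Lc : ℤ) - 1 then (1 : ℝ) else 0)))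
              * dM (coDressKBmAt (toSite r) Lc (KInvStep (d := d) Lc (j + 1))) Lc (SpureRecAt d Lc (toSite r) cE cVH cΛ (j + 1)) (M1At d Lc (toSite r) cΛ (j + 1)) ν y'
                  u x (Sum.inl κ) (Sum.inl κ₂)) := by
  classical
  have hLc : 1 ≤ Lc := one_le_of_neZero Lc
  obtain ⟨m, ⟨B, hmB⟩, hm0, hper, hT⟩ := exists_periodic_potential_exitCharge hr cE cVH cΛ hαβ j
  refine ⟨m, ⟨B, hmB⟩, hm0, hper, hT, fun ν y' y => ?_⟩
  simp only [hT]
  set G := coDressKBmAt (toSite r) Lc (KInvStep (d := d) Lc (j + 1)) with hGdef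
  obtain ⟨δG, CG, hδG, hCG, hG⟩ := decays_coDressKBmAt_KInvStep (d := d) hr (j + 1)
  obtain ⟨Cs, δs, hδs, hS⟩ := locStencil_SpureRecAt (d := d) (Lc := Lc) hLc hr cE cVH cΛ (j + 1)
  have hCs : 0 ≤ Cs := (hS 0 0).nonneg (Sum.inl 0)
  have hδ : 0 < min δs δG := lt_min hδs hδG
  have hSδ : LocStencil (SpureRecAt d Lc (toSite r) cE cVH cΛ (j + 1)) Cs (min δs δG) := locStencil_mono hS hCs (min_le_left _ _)
  have hMδ := vertexFamily_M1At (d := d) (Lc := Lc) hLc hr cΛ (j + 1) hδ.le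
  have hW := vertexFamily_dM (N := Lc) hG hCG hSδ hMδ hδ (min_le_right _ _) ν y'
  have hδ2 : 0 < min δs δG / 2 := by positivity
  have hWs : Spr (dM G Lc (SpureRecAt d Lc (toSite r) cE cVH cΛ (j + 1)) (M1At d Lc (toSite r) cΛ (j + 1)) ν y') :=
    ⟨_, _, hδ2, decays_of_biLoc hW hδ2.le⟩
  have hB0 : 0 ≤ B := (abs_nonneg _).trans (hmB 0 0)
  have hEb : ∀ κ u, |wVH d Lc (j + 1) * ∑' v, ∑ l : Fin (d + 1), wΦ (N := Lc ^ (j + 1)) κ l (u - v) * m l v|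
      ≤ |wVH d Lc (j + 1)| * (B * ∑ κ : Fin (d + 1), ∑ l : Fin (d + 1), ∑' z : Site (d + 1), |wΦ (N := Lc ^ (j + 1)) κ l z|) := by
    intro κ u
    rw [abs_mul]
    refine mul_le_mul_of_nonneg_left ((abs_tsum_sum_wΦ_mul_le (Lc ^ (j + 1)) hmB κ u).trans (mul_le_mul_of_nonneg_left ?_ hB0)) (abs_nonneg _)
    exact Finset.single_le_sum (f := fun κ => ∑ l : Fin (d + 1), ∑' z : Site (d + 1), |wΦ (N := Lc ^ (j + 1)) κ l z|)
      (fun κ _ => Finset.sum_nonneg fun l _ => tsum_nonneg fun z => abs_nonneg _) (Finset.mem_univ κ)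
  obtain ⟨CA, Cs', CM, δA, hδA, hAf, -, -⟩ := exists_vertexFamily_combResponse (d := d) (Lc := Lc) hLc hr cE cVH cΛ (j + 1)
  have hw : ∀ κ u, |∑' x, ∑ κ₂, comp G (dM G Lc (SpureRecAt d Lc (toSite r) cE cVH cΛ (j + 1)) (M1At d Lc (toSite r) cΛ (j + 1)) ν y') u x (Sum.inl κ) (Sum.inl κ₂)
      * gaugeWt Lc y κ₂ x| ≤ ((d + 1 : ℕ) * CA * Zl (d + 1) δA) * Real.exp (-δA * l1 (u - (Lc : ℤ) • y')) :=
    fun κ u => abs_read_le (hAf ν y') hδA (fun κ₂ x => abs_gaugeWt_le_one Lc y κ₂ x) u (Sum.inl κ)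
  have hsw : ∀ κ, Summable fun u => (∑' x, ∑ κ₂, comp G (dM G Lc (SpureRecAt d Lc (toSite r) cE cVH cΛ (j + 1)) (M1At d Lc (toSite r) cΛ (j + 1)) ν y') u x (Sum.inl κ) (Sum.inl κ₂)
      * gaugeWt Lc y κ₂ x) * (wVH d Lc (j + 1) * ∑' v, ∑ l : Fin (d + 1), wΦ (N := Lc ^ (j + 1)) κ l (u - v) * m l v) := by
    intro κ
    refine Summable.of_norm_bounded ((((summable_exp_shift' hδA ((Lc : ℤ) • y')).mul_left ((d + 1 : ℕ) * CA * Zl (d + 1) δA)).mul_right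
      (|wVH d Lc (j + 1)| * (B * ∑ κ : Fin (d + 1), ∑ l : Fin (d + 1), ∑' z : Site (d + 1), |wΦ (N := Lc ^ (j + 1)) κ l z|)))) (fun u => ?_)
    rw [Real.norm_eq_abs, abs_mul]
    exact mul_le_mul (hw κ u) (hEb κ u) (abs_nonneg _) ((abs_nonneg _).trans (hw κ u))
  have hL : (∑ κ : Fin (d + 1), ∑' u : Site (d + 1),
        (∑' x, ∑ κ₂, comp G (dM G Lc (SpureRecAt d Lc (toSite r) cE cVH cΛ (j + 1)) (M1At d Lc (toSite r) cΛ (j + 1)) ν y') u x (Sum.inl κ) (Sum.inl κ₂) * gaugeWt Lc y κ₂ x)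
          * (wVH d Lc (j + 1) * ∑' v, ∑ l : Fin (d + 1), wΦ (N := Lc ^ (j + 1)) κ l (u - v) * m l v))
      = ∑' u, ∑ κ, (wVH d Lc (j + 1) * ∑' v, ∑ l : Fin (d + 1), wΦ (N := Lc ^ (j + 1)) κ l (u - v) * m l v)
          * (∑' x, ∑ κ₂, comp G (dM G Lc (SpureRecAt d Lc (toSite r) cE cVH cΛ (j + 1)) (M1At d Lc (toSite r) cΛ (j + 1)) ν y') u x (Sum.inl κ) (Sum.inl κ₂)
              * gaugeWt Lc y κ₂ x) := by
    rw [← Summable.tsum_finsetSum (fun κ _ => hsw κ)]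
    exact tsum_congr fun u => Finset.sum_congr rfl fun κ _ => mul_comm _ _
  rw [hL]
  simp only [gaugeWt_eq_dz]
  exact E2imageRead_comp_eq_sourceRead_succ hr j hWs hW hδ2 hmB hper (ψ := fun w : Site (d + 1) => if blk Lc w = y then (1 : ℝ) else 0) (Bψ := 1)
    (fun u => by split_ifs <;> simp)

/-- NOT IN PRINT; OUR BOOKKEEPING.  **(W-γ)_{j+1}, EXIT⊗EXIT, MODULO ONE DISPLAYED IDENTITY** (in-block root, `α ≠ β`, every `j`, slot `(ν,y′)`, label `y`, constant `c`): `hP` = «for every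
bounded comb-gauged `Lc`-periodic `m` representing `C_S`, the `n_m ⊗ d1_{B(y)}` source pairing of `𝒟_{j+1}(e)` is `c·Σ'_u Σ_κ 𝟙[blk(u+e_κ) = y]·colH G_{j+1}(e) κ u·C_S(κ,u)`» (the
level-(j+1) twin of leaf-06's ENGINE (M1)+(M3), NOT typed) ⟹ the (γ) exit⊗exit charge is `(−4c)` times the END-POINT (α⁺) charge — FILE F §2 one level up (§5 ⨾ INTENT 1 §6). -/
theorem wardGamma_exit_of_sourcePairing (hr : r ∈ box (d + 1) Lc) (cE cVH cΛ : ℝ) {α β : Fin (d + 1)} (hαβ : α ≠ β) (j : ℕ)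
    (ν : Fin (d + 1)) (y' y : Site (d + 1)) (c : ℝ)
    (hP : ∀ m : Form1 (d + 1) ℝ, (∃ B : ℝ, ∀ κ u, |m κ u| ≤ B) → (∀ κ u, IsCombBondAt (toSite r) Lc κ u → m κ u = 0) →
      (∀ κ x v, m κ (x + (Lc : ℤ) • v) = m κ x) →
      (∀ (ν : Fin (d + 1)) (y' : Site (d + 1)), ∑' xz : Site (d + 1) × Site (d + 1),
        (if xz.1 α % (Lc : ℤ) = (Lc : ℤ) - 1 then (1 : ℝ) else 0) * (if xz.2 β % (Lc : ℤ) = (Lc : ℤ) - 1 then (1 : ℝ) else 0)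
          * SpureRecAt d Lc (toSite r) cE cVH cΛ (j + 1) ν y' xz.1 xz.2 (Sum.inl α) (Sum.inl β)
        = wVH d Lc (j + 1) * ∑' v, ∑ l : Fin (d + 1), wΦ (N := Lc ^ (j + 1)) ν l (y' - v) * m l v) →
      ∑' x, ∑ κ₂, gaugeWt Lc y κ₂ x * (∑' u, ∑ κ,
          (axProjAt (toSite r) Lc m κ u - ((Lc : ℝ) ^ (d + 1))⁻¹ * (contourSum Lc m κ 0 * (if u κ % (Lc : ℤ) = (Lc : ℤ) - 1 then (1 : ℝ) else 0)))
            * dM (coDressKBmAt (toSite r) Lc (KInvStep (d := d) Lc (j + 1))) Lc (SpureRecAt d Lc (toSite r) cE cVH cΛ (j + 1)) (M1At d Lc (toSite r) cΛ (j + 1)) ν y'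
                u x (Sum.inl κ) (Sum.inl κ₂))
        = c * ∑' u : Site (d + 1), ∑ κ : Fin (d + 1), (if blk Lc (u + Pi.single κ 1) = y then (1 : ℝ) else 0)
            * colH (coDressKBmAt (toSite r) Lc (KInvStep (d := d) Lc (j + 1))) Lc ν y' κ u
            * ∑' xz : Site (d + 1) × Site (d + 1), ((if xz.1 α % (Lc : ℤ) = (Lc : ℤ) - 1 then (1 : ℝ) else 0) * (if xz.2 β % (Lc : ℤ) = (Lc : ℤ) - 1 then (1 : ℝ) else 0))
                * SpureRecAt d Lc (toSite r) cE cVH cΛ (j + 1) κ u xz.1 xz.2 (Sum.inl α) (Sum.inl β)) :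
    (∑ κ : Fin (d + 1), ∑' u : Site (d + 1),
        (∑' x, ∑ κ₂, comp (coDressKBmAt (toSite r) Lc (KInvStep (d := d) Lc (j + 1)))
            (dM (coDressKBmAt (toSite r) Lc (KInvStep (d := d) Lc (j + 1))) Lc (SpureRecAt d Lc (toSite r) cE cVH cΛ (j + 1)) (M1At d Lc (toSite r) cΛ (j + 1)) ν y')
            u x (Sum.inl κ) (Sum.inl κ₂) * gaugeWt Lc y κ₂ x)
          * ∑' xz : Site (d + 1) × Site (d + 1), ((if xz.1 α % (Lc : ℤ) = (Lc : ℤ) - 1 then (1 : ℝ) else 0) * (if xz.2 β % (Lc : ℤ) = (Lc : ℤ) - 1 then (1 : ℝ) else 0))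
              * SpureRecAt d Lc (toSite r) cE cVH cΛ (j + 1) κ u xz.1 xz.2 (Sum.inl α) (Sum.inl β))
      = (-4 * c) * ((1 / 2 : ℝ) *
        ((∑ κ : Fin (d + 1), ∑' u : Site (d + 1),
            colH (coDressKBmAt (toSite r) Lc (KInvStep (d := d) Lc (j + 1))) Lc ν y' κ u
              * ((if y' + Pi.single ν 1 = y then (1 / 2 : ℝ) else 0) - (if blk Lc (u + Pi.single κ 1) = y then (1 / 2 : ℝ) else 0))
              * ∑' xz : Site (d + 1) × Site (d + 1), ((if xz.1 α % (Lc : ℤ) = (Lc : ℤ) - 1 then (1 : ℝ) else 0) * (if xz.2 β % (Lc : ℤ) = (Lc : ℤ) - 1 then (1 : ℝ) else 0))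
                  * SpureRecAt d Lc (toSite r) cE cVH cΛ (j + 1) κ u xz.1 xz.2 (Sum.inl α) (Sum.inl β))
          + ∑ ρ' : Fin (d + 1), ∑' w : Site (d + 1),
            colM (coDressKBmAt (toSite r) Lc (KInvStep (d := d) Lc (j + 1))) Lc ν y' ρ' w
              * ((if y' + Pi.single ν 1 = y then (1 / 2 : ℝ) else 0) - (if w + Pi.single ρ' 1 = y then (1 / 2 : ℝ) else 0))
              * ∑' xz : Site (d + 1) × Site (d + 1), ((if xz.1 α % (Lc : ℤ) = (Lc : ℤ) - 1 then (1 : ℝ) else 0) * (if xz.2 β % (Lc : ℤ) = (Lc : ℤ) - 1 then (1 : ℝ) else 0))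
                  * M1At d Lc (toSite r) cΛ (j + 1) ρ' w xz.1 xz.2 (Sum.inl α) (Sum.inl β))) := by
  obtain ⟨m, hB, hm0, hper, hT, hγ⟩ := gaugeCharge_exit_eq_sourcePairing hr cE cVH cΛ hαβ j
  exact wardGamma_exit_of_gammaRead hr cE cVH cΛ hαβ j ν y' y ((hγ ν y' y).trans (hP m hB hm0 hper hT))

end Summit.QuantumFields.BalabanUV.Beta.GAN24.ExitChargeSourcePairing

end
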